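import Summits.Ventures.PackingBounds.Configurations.KerdockCode16
import Summits.Ventures.PackingBounds.Configurations.SectionTransfer
import Summits.Ventures.PackingBounds.SphericalCodes.DimensionLift

/-!
# Derived codes of the shortened Nordstrom–Robinson code: `A(14, arccos 1/6) ≥ 70`, `A(14, arccos 1/10) ≥ 42`

Framing: lottery ticket; floor = certified bounds/negative ranges. Venture `PackingBounds` (cell `pub-packcert`, seat
`pub-packcert-sdp`), ATTAINED side of the B2c cells `(14, 1/5)` (Leech coordinate section `64`,
`Config.Leech.PrefixFifth.exists_code_dim14_fifth_64`; certified three-point value `121`), `(14, 1/9)`, `(14, 1/10)` and, by pole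
lifts, `(15, 1/10)` … `(17, 1/10)` (no attained entry so far beyond the cross-polytope `2n`; certified values `52`, `45`, `51`,
`58`, `66`). Source object: the tree's Kerdock spherical code `Config.KerdockCode16.vecs` (`256` sign vectors of the
Nordstrom–Robinson code `NR(16, 256, 6)` and `±4e_i`). Let `C ⊆ (±1)¹⁵` be the shortened code (words with `v₁₅ = 1`,
truncated; `128` words, dot products `3, -1, -5`) and `x = (1, …, 1) ∈ C`. The DERIVED code of `C` at dot product `t`
is `{y ∈ C : x·y = t}` projected orthogonally to `x` [Conway–Sloane Ch. 14 Example 3 uses the same device on the Leech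
lattice: `4600 → 891 → 336 → 170`]:
* `t = 3` (`70` words of weight `6`): the vectors `5y - x ∈ {4, -6}¹⁵`, squared length `360`, pairwise dot products
  `60, -40, -140` (`42 / 9 / 18` times around every word), i.e. cosines `1/6, -1/9, -7/18`, all orthogonal to `x` — a
  `70`-point code of a `14`-space with cosines `≤ 1/6`: **`A(14, arccos 1/6) ≥ 70`**, hence **`A(14, arccos 1/5) ≥ 70`**;
* `t = -5` (`42` words of weight `10`): the vectors `3y + x ∈ {4, -2}¹⁵`, squared length `120`, dot products `12, -24, -60`
  (`30 / 5 / 6` times), cosines `1/10, -1/5, -1/2`: **`A(14, arccos 1/10) ≥ 42`** (hence `A(14, arccos 1/9) ≥ 42`), and with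
  poles **`A(15, arccos 1/10) ≥ 44`, `A(16, ·) ≥ 46`, `A(17, ·) ≥ 48`** (for `n = 18` the Leech-section derived
  code `51` of `LeechDerivedSmallAngles.lean` is better than the lift `50`).
Rows are DERIVED from `KerdockCode16.vecs` by `filter`/`map` (no new data); the configuration checks (`shapeOK`, `histOK`,
`normalsOK`, `orthOK`) run by `decide`, and `Config.exists_section` moves the rows into `ℝ¹⁴` (one normal `x`). Kernel brackets
with the tree's rows: `70 ≤ A(14, arccos 1/5) ≤ 123` (`code_dim14_fifth_le_123`), and `42 ≤ A(14, arccos 1/10)` against the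
certified `45`.

## References
* J. H. Conway, N. J. A. Sloane, *Sphere Packings, Lattices and Groups*, 3rd ed., Ch. 2 §8 (Nordstrom–Robinson code),
  Ch. 14 Example 3 (derived spherical codes). [`ConwaySloane1999`]
* H. Cohn, D. de Laat, N. Leijenhorst, arXiv:2403.16874 (2024), §1.2 (the Kerdock code `(16, 288, 1/4)`). [`CohnDelaatLeijenhorst2024`]
-/

namespace Summit.Ventures.PackingBounds.Config.KerdockDerived

open Finset Summit.Ventures.PackingBounds.Config

/-- The normal: the all-ones word `x` of the shortened code (length `15`). -/
def normals : List (List ℤ) := [[1, 1, 1, 1, 1, 1, 1, 1, 1, 1, 1, 1, 1, 1, 1]]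

/-- Kernel check: one normal of length `15` with nonzero self-product. -/
theorem normals_ok : normalsOK normals 15 = true := by decide +kernel

/-! ## The derived code at dot product `3`: `70` points, cosines `≤ 1/6` -/

/-- Rows `5y - x` for the `70` shortened words `y` with `x·y = 3` (Kerdock sign vectors with `v₁₅ = 1` and coordinate sum
`3` on the first `15` coordinates). -/
def rows70 : List (List ℤ) :=
  (KerdockCode16.vecs.filter fun v => v.getD 15 0 == 1 && (v.take 15).sum == 3).map fun v =>
    (v.take 15).map fun c => 5 * c - 1

/-- Distance table of the `70`-point code: dot products `60` (`42` times), `-40` (`9`), `-140` (`18`) at squared length `360`. -/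
def table70 : List (ℤ × ℕ) := [(60, 42), (-40, 9), (-140, 18)]

/-- Kernel check: `70` rows. -/
theorem length_rows70 : rows70.length = 70 := by decide +kernel

set_option maxRecDepth 100000 in
/-- Kernel check: rows of length `15`, self-product `360`. -/
theorem shape_rows70 : shapeOK rows70 15 (360 : ℤ) = true := by decide +kernel

/-- Kernel check: table keys distinct and `≠ 360`. -/
theorem keys_table70 : keysOK table70 (360 : ℤ) = true := by decide

set_option maxRecDepth 100000 in
/-- Kernel check: the distance distribution around every row. -/
theorem hist_rows70 : histOK rows70 table70 rows70 = true := by decide +kernel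

set_option maxRecDepth 100000 in
/-- Kernel check: every row is orthogonal to the normal `x`. -/
theorem orth_rows70 : orthOK normals rows70 = true := by decide +kernel

/-- The rows are pairwise distinct. -/
theorem nodup_rows70 : rows70.Nodup := nodup_of_checks shape_rows70 keys_table70 hist_rows70

/-- `ι 360 > 0`. -/
private theorem hq70 : 0 < (Int.castRingHom ℝ) (360 : ℤ) := by simp

/-- **The `70`-point derived code in `ℝ¹⁴`**: unit vectors with pairwise inner products in `{1/6, -1/9, -7/18}` (so `≤ 1/6`)
and the tabulated `a`-energy `70 · (42 a(1/6) + 9 a(-1/9) + 18 a(-7/18))`. [cite: ConwaySloane1999, Ch. 14 Example 3] -/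
theorem exists_config70 : ∃ C : Finset (EuclideanSpace ℝ (Fin 14)), C.card = 70 ∧ (∀ x ∈ C, ‖x‖ = 1) ∧
    (∀ x ∈ C, ∀ y ∈ C, x ≠ y → inner ℝ x y ≤ 1 / 6) ∧
    ∀ a : ℝ → ℝ, ∑ x ∈ C, ∑ y ∈ C.erase x, a (inner ℝ x y) =
      (70 : ℝ) * (42 * a (1 / 6) + 9 * a (-1 / 9) + 18 * a (-7 / 18)) := by
  obtain ⟨C, hc, hn, hi, he⟩ := exists_section Int.cast_injective hq70 shape_rows70 keys_table70 hist_rows70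
    nodup_rows70 normals normals_ok orth_rows70 (n := 14) (by decide)
  refine ⟨C, by rw [hc, length_rows70], hn, fun x hx y hy hxy => ?_, fun a => ?_⟩
  · obtain ⟨p, hp, hpe⟩ := hi x hx y hy hxy
    rw [hpe]
    simp only [table70, List.mem_cons, List.not_mem_nil, or_false] at hp
    rcases hp with rfl | rfl | rfl <;> norm_num
  · rw [he a, length_rows70]
    simp only [table70, List.map_cons, List.map_nil, List.sum_cons, List.sum_nil, Nat.cast_ofNat]
    norm_num
    ring

/-- **`A(14, arccos 1/6) ≥ 70`.** [cite: ConwaySloane1999, Ch. 14 Example 3] -/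
theorem exists_code_dim14_sixth_70 : ∃ C : Finset (EuclideanSpace ℝ (Fin 14)), C.card = 70 ∧
    (∀ x ∈ C, ‖x‖ = 1) ∧ ∀ x ∈ C, ∀ y ∈ C, x ≠ y → inner ℝ x y ≤ 1 / 6 := by
  obtain ⟨C, hc, hn, hi, _⟩ := exists_config70
  exact ⟨C, hc, hn, hi⟩

/-- **`A(14, arccos 1/5) ≥ 70`** (B2c cell `(14, 1/5)`; was `64`). [cite: ConwaySloane1999, Ch. 14 Example 3] -/
theorem exists_code_dim14_fifth_70 : ∃ C : Finset (EuclideanSpace ℝ (Fin 14)), C.card = 70 ∧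
    (∀ x ∈ C, ‖x‖ = 1) ∧ ∀ x ∈ C, ∀ y ∈ C, x ≠ y → inner ℝ x y ≤ 1 / 5 := by
  obtain ⟨C, hc, hn, hi⟩ := exists_code_dim14_sixth_70
  exact ⟨C, hc, hn, fun x hx y hy hxy => (hi x hx y hy hxy).trans (by norm_num)⟩

/-! ## The derived code at dot product `-5`: `42` points, cosines `≤ 1/10` -/

/-- Rows `3y + x` for the `42` shortened words `y` with `x·y = -5` (coordinate sum `-5` on the first `15` coordinates). -/
def rows42 : List (List ℤ) :=
  (KerdockCode16.vecs.filter fun v => v.getD 15 0 == 1 && (v.take 15).sum == -5).map fun v =>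
    (v.take 15).map fun c => 3 * c + 1

/-- Distance table of the `42`-point code: dot products `12` (`30` times), `-24` (`5`), `-60` (`6`) at squared length `120`. -/
def table42 : List (ℤ × ℕ) := [(12, 30), (-24, 5), (-60, 6)]

/-- Kernel check: `42` rows. -/
theorem length_rows42 : rows42.length = 42 := by decide +kernel

set_option maxRecDepth 100000 in
/-- Kernel check: rows of length `15`, self-product `120`. -/
theorem shape_rows42 : shapeOK rows42 15 (120 : ℤ) = true := by decide +kernel

/-- Kernel check: table keys distinct and `≠ 120`. -/
theorem keys_table42 : keysOK table42 (120 : ℤ) = true := by decide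

set_option maxRecDepth 100000 in
/-- Kernel check: the distance distribution around every row. -/
theorem hist_rows42 : histOK rows42 table42 rows42 = true := by decide +kernel

set_option maxRecDepth 100000 in
/-- Kernel check: every row is orthogonal to the normal `x`. -/
theorem orth_rows42 : orthOK normals rows42 = true := by decide +kernel

/-- The rows are pairwise distinct. -/
theorem nodup_rows42 : rows42.Nodup := nodup_of_checks shape_rows42 keys_table42 hist_rows42

/-- `ι 120 > 0`. -/
private theorem hq42 : 0 < (Int.castRingHom ℝ) (120 : ℤ) := by simp

/-- **The `42`-point derived code in `ℝ¹⁴`**: unit vectors with pairwise inner products in `{1/10, -1/5, -1/2}` (so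
`≤ 1/10`) and `a`-energy `42 · (30 a(1/10) + 5 a(-1/5) + 6 a(-1/2))`. [cite: ConwaySloane1999, Ch. 14 Example 3] -/
theorem exists_config42 : ∃ C : Finset (EuclideanSpace ℝ (Fin 14)), C.card = 42 ∧ (∀ x ∈ C, ‖x‖ = 1) ∧
    (∀ x ∈ C, ∀ y ∈ C, x ≠ y → inner ℝ x y ≤ 1 / 10) ∧
    ∀ a : ℝ → ℝ, ∑ x ∈ C, ∑ y ∈ C.erase x, a (inner ℝ x y) =
      (42 : ℝ) * (30 * a (1 / 10) + 5 * a (-1 / 5) + 6 * a (-1 / 2)) := by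
  obtain ⟨C, hc, hn, hi, he⟩ := exists_section Int.cast_injective hq42 shape_rows42 keys_table42 hist_rows42
    nodup_rows42 normals normals_ok orth_rows42 (n := 14) (by decide)
  refine ⟨C, by rw [hc, length_rows42], hn, fun x hx y hy hxy => ?_, fun a => ?_⟩
  · obtain ⟨p, hp, hpe⟩ := hi x hx y hy hxy
    rw [hpe]
    simp only [table42, List.mem_cons, List.not_mem_nil, or_false] at hp
    rcases hp with rfl | rfl | rfl <;> norm_num
  · rw [he a, length_rows42]
    simp only [table42, List.map_cons, List.map_nil, List.sum_cons, List.sum_nil, Nat.cast_ofNat]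
    norm_num
    ring

/-- **`A(14, arccos 1/10) ≥ 42`** (B2c cell `(14, 1/10)`, certified `≤ 45`). [cite: ConwaySloane1999, Ch. 14 Example 3] -/
theorem exists_code_dim14_tenth_42 : ∃ C : Finset (EuclideanSpace ℝ (Fin 14)), C.card = 42 ∧
    (∀ x ∈ C, ‖x‖ = 1) ∧ ∀ x ∈ C, ∀ y ∈ C, x ≠ y → inner ℝ x y ≤ 1 / 10 := by
  obtain ⟨C, hc, hn, hi, _⟩ := exists_config42
  exact ⟨C, hc, hn, hi⟩

/-- **`A(14, arccos 1/9) ≥ 42`** (B2c cell `(14, 1/9)`, certified `≤ 52`). [cite: ConwaySloane1999, Ch. 14 Example 3] -/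
theorem exists_code_dim14_ninth_42 : ∃ C : Finset (EuclideanSpace ℝ (Fin 14)), C.card = 42 ∧
    (∀ x ∈ C, ‖x‖ = 1) ∧ ∀ x ∈ C, ∀ y ∈ C, x ≠ y → inner ℝ x y ≤ 1 / 9 := by
  obtain ⟨C, hc, hn, hi⟩ := exists_code_dim14_tenth_42
  exact ⟨C, hc, hn, fun x hx y hy hxy => (hi x hx y hy hxy).trans (by norm_num)⟩

/-- **`A(15, arccos 1/10) ≥ 44`** (two poles; certified `≤ 51`). [cite: ConwaySloane1999, Ch. 14 Example 3] -/
theorem exists_code_dim15_tenth_44 : ∃ C : Finset (EuclideanSpace ℝ (Fin 15)), C.card = 44 ∧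
    (∀ x ∈ C, ‖x‖ = 1) ∧ ∀ x ∈ C, ∀ y ∈ C, x ≠ y → inner ℝ x y ≤ 1 / 10 := by
  obtain ⟨C, hc, h1, h2⟩ := exists_code_dim14_tenth_42
  obtain ⟨C', hc', h1', h2'⟩ := SphericalCodes.exists_code_lift_succ (by norm_num) C h1 h2
  exact ⟨C', by rw [hc', hc], h1', h2'⟩

/-- **`A(16, arccos 1/10) ≥ 46`** (certified `≤ 58`). [cite: ConwaySloane1999, Ch. 14 Example 3] -/
theorem exists_code_dim16_tenth_46 : ∃ C : Finset (EuclideanSpace ℝ (Fin 16)), C.card = 46 ∧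
    (∀ x ∈ C, ‖x‖ = 1) ∧ ∀ x ∈ C, ∀ y ∈ C, x ≠ y → inner ℝ x y ≤ 1 / 10 := by
  obtain ⟨C, hc, h1, h2⟩ := exists_code_dim15_tenth_44
  obtain ⟨C', hc', h1', h2'⟩ := SphericalCodes.exists_code_lift_succ (by norm_num) C h1 h2
  exact ⟨C', by rw [hc', hc], h1', h2'⟩

/-- **`A(17, arccos 1/10) ≥ 48`** (certified `≤ 66`). [cite: ConwaySloane1999, Ch. 14 Example 3] -/
theorem exists_code_dim17_tenth_48 : ∃ C : Finset (EuclideanSpace ℝ (Fin 17)), C.card = 48 ∧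
    (∀ x ∈ C, ‖x‖ = 1) ∧ ∀ x ∈ C, ∀ y ∈ C, x ≠ y → inner ℝ x y ≤ 1 / 10 := by
  obtain ⟨C, hc, h1, h2⟩ := exists_code_dim16_tenth_46
  obtain ⟨C', hc', h1', h2'⟩ := SphericalCodes.exists_code_lift_succ (by norm_num) C h1 h2
  exact ⟨C', by rw [hc', hc], h1', h2'⟩

end Summit.Ventures.PackingBounds.Config.KerdockDerived
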